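import Summits.QuantumFields.BalabanUV.Beta.GAN24.DressedOrderZeroSlotLaw
import Summits.QuantumFields.BalabanUV.Beta.GAN24.HardColumnChains

/-!
# `BalabanUV.Beta.GAN24.DressedOrderZeroChain` — binder row G-an2-4 ∕ (CONV-C), route R7 «TWO CURRENCIES», S4 WITH A DRESSED ORDER-ZERO
# SLOT ALONG THE TOWER: the V3-type chain `Xᴴ·(∇ᴴ(diag h₁)ᴴ𝒢(diag h₂)∇)·X` — «gradient leg · vertex · covariance · vertex · gradient leg»,
# (P-R7a)'s V3 `⟨h∇u_y, G_k h∇u_{y′}⟩` — is entrywise Cauchy at rate `L^{−k}` for the SOFT and the HARD legs, modulo the three NE2-currency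
# letters of the background `h` (size `α`, lattice Lipschitz `β`, two-level consistency `βc·n_k⁻¹`) and NOTHING ELSE

NOT IN PRINT; OUR PROOF ATTEMPT (prover part P3 of row G-an2-4, fibre∕strip («Woodbury») lineage, gen 26; CRUX TEAM (2), ruling «YM
REDIRECT TOWARDS THE SUMMIT», 2026-08-21).  HONEST DEPENDENCY (cell records, verbatim): «continuum YM on T⁴ ⇐ BetaPertH ∧ nine spine
estimates (0/9 proved); BetaPertH ⇐ (D1) ∧ (D4) ∧ CAP+tail; G-an2-4 gates asym, D1 and NE2/3/4.»  HONEST FRAMING (cell contract, verbatim):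
«discharging `BetaPertH` makes Bałaban's UV stability UNCONDITIONAL — a real constructive-QFT result; it is NOT the continuum limit and NOT
the Clay problem.»  ABSOLUTE RULE: nothing printed is a hypothesis; no `def … : Prop`, no sorry; [folklore] algebra over TREE objects BY NAME.

## What is proved (`HOME/beta/ROUTES-GAN24.md` v8.1 §2 R7 S3 (ρ2)(ρ5), S4 «vertex slots by (ρ5) with (ρ3)'s background-leg rate inside»)

Backgrounds `W₁, W₂ : (k : ℕ) → (idx L M k → ℂ)` are DATA; their letters are EXPLICIT HYPOTHESES (no bundling): size `‖W k i‖ ≤ α`, lattice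
Lipschitz `‖W k x − W k (x − e_μ)‖ ≤ β∕n_k` (every direction), consistency at the block parent `‖W (k+1) x′ − W k (parT x′)‖ ≤ βc∕n_k` — NE2's
`PerturbationAlgebra.BoundedBackground` ∕ `FirstOrderBackgroundModel` currency, `n_k = L^k`.
 * §1 the dressed slot along the tower `DRop W₁ W₂ k μ μ′ := ∇_{k,μ}ᴴ·(diag W₁ k)ᴴ·𝒢_k·(diag W₂ k)·∇_{k,μ′}`, `DRopsucc` (level `k+1` read at
   `L·n_k`), `‖DRop‖, ‖DRopsucc‖ ≤ (α+β)²·Cst` (`DressedOrderZeroSlotLaw.opNorm_dressedSlot_le`);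
 * §2 the dressed law along the tower **`opNorm_faceK_dressed_sub_le_lev`**: `‖K_μᴴ·T_{k+1}·K_{μ′} − T_k‖ ≤ (α²·CK + 2α·L²·Cst·βc)·L^{−k}`
   (`T_k = (diag W₁ k)ᴴ𝒢_k(diag W₂ k)`), and the sandwich `J_kᴴ·DRopsucc·J_k − DRop = ∇ᴴ(K_μᴴT_{k+1}K_{μ′} − T_k)∇′`;
 * §3 GENERIC LEGS **`norm_dressedLegChain_sub_le`**: legs `‖X₁‖, ‖Y₀‖ ≤ αℓ`, one-step rates `≤ ε`, H¹ bounds `‖∇X₀‖, ‖∇Y₀‖ ≤ βℓ` ⟹ every entry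
   of `X₁ᴴ·DRopsucc·Y₁ − X₀ᴴ·DRop·Y₀` is `≤ 2·αℓ·(α+β)²Cst·ε + βℓ²·(α²CK + 2αL²Cst·βc)·L^{−k}` (`SoftColumnOrderZeroChain.legChain_sub_eq`);
 * §4 the INSTANCES: **`norm_softDressedChain_succ_sub_le`** (soft legs `M̃`, `‖M̃‖, ‖∇M̃‖ ≤ a·Cst`, `ε = a·CQH·L^{−k}`) and
   **`norm_hardDressedChain_succ_sub_le`** (hard legs `M̂ = n^{−d∕2}H_k`, `HardColumnChains`: `Cst∕γ`, `CHH·L^{−k}`) — the V3-type chains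
   `⟨h₁∇_μu_p, 𝒢_k h₂∇_{μ′}u_r⟩` of the soft ∕ hard unit-sourced legs are Cauchy at rate `L^{−k}` MODULO THE BACKGROUND's THREE LETTERS.
For `h` = the physical soft column `√(n^d)·M̃e_b` the size letter is leaf-03's `SoftColumnSupLetter.sqrt_mul_norm_Mtil_le` (tree, p263836); the
Lipschitz and consistency letters on this carrier are NOT in the tree (INTERFACE REQUEST lines (R7-HLIP) ∕ (R7-HCONS) of this gen).

HONEST SCOPE.  MODEL chains on typed objects, backgrounds as DATA (no claim that a given Bałaban leg satisfies the letters); `U = 1`; every torus,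
`L ≥ 1`, `d ≥ 1`; supplier work on the route of record; zero on the D1 grid; NOT (CONV-C) (a list), NOT (ρ3), NEVER «G-an2-4 closed», NOT NE2, NOT
D1, NOT BetaPertH, NOT continuum, NOT Clay.  Locators (text only): [Balaban1984PropagatorsI] (1.31) p. 23, Prop. 1.1 (1.89) p. 33; [King1986] Prop.
3.8 p. 664–665, Lemma 4.5 (4.38) p. 674.  Provenance: prover-b2b-balaban-gan24-p3-g26-0 (unit `b2b-balaban-gan24-p3`, gen 26), 2026-08-21.
-/

noncomputable section

open scoped BigOperators ComplexConjugate Matrix Matrix.Norms.L2Operator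
open Finset

namespace Summit.QuantumFields.BalabanUV.Beta.GAN24.DressedOrderZeroChain

open Literature.MathematicalPhysics.QuantumFieldTheory.Balaban1983to89.B5Prop11Plancherel
open Literature.MathematicalPhysics.QuantumFieldTheory.Balaban1983to89.B5G183RateUnitTower (lev lev_neZero)
open Summit.QuantumFields.BalabanUV.T4Continuum
open Summit.QuantumFields.BalabanUV.T4Continuum.BalabanAveragedTowerUnit (idx lev_succ' one_le_lev' cast_lev' calGlev)
open Summit.QuantumFields.BalabanUV.T4Continuum.BalabanMinimizerLaw
open Summit.QuantumFields.BalabanUV.T4Continuum.BlockPairingGeometry (parT)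
open Summit.QuantumFields.BalabanUV.T4Continuum.KingLaplacianConsistency (gradC gradF)
open Summit.QuantumFields.BalabanUV.T4Continuum.BalabanAveragedCoercive (gammaB gammaB_pos)
open Summit.QuantumFields.BalabanUV.Beta.GAN24.SoftColumnVertexRate (opNorm_Mtil_le)
open Summit.QuantumFields.BalabanUV.Beta.GAN24.SoftColumnCovarianceChain (norm_conjTranspose_mul_mul_apply_le)
open Summit.QuantumFields.BalabanUV.Beta.GAN24.OrderZeroSlotLaw (faceK CK CK_nonneg)
open Summit.QuantumFields.BalabanUV.Beta.GAN24.SoftColumnOrderZeroChain (opNorm_grad_Mtil_le legChain_sub_eq)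
open Summit.QuantumFields.BalabanUV.Beta.GAN24.HardColumnChains (Mhat CHH CHH_nonneg opNorm_Mhat_le opNorm_grad_Mhat_le opNorm_Mhat_succ_sub_le)
open Summit.QuantumFields.BalabanUV.Beta.GAN24.DressedOrderZeroSlotLaw

variable {d : ℕ} (L : ℕ) [NeZero L] (M : Fin d → ℕ) [hM : ∀ μ, NeZero (M μ)] (a : ℝ) (ha : 0 < a)

/-! ## §1 The dressed slot along the tower and its boundedness -/

/-- identity transport of a level-`(k+1)` field to the syntactic successor level `L·n_k` (the index types are definitionally equal; cf.
`BalabanMinimizerLaw.atSucc'`). [folklore] -/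
def atSuccV (k : ℕ) (w : idx L M (k + 1) → ℂ) : Tor (fine (L * lev L k) M) × Fin d → ℂ := w

/-- the dressed middle operator `T_k := (diag W₁ k)ᴴ·𝒢_k·(diag W₂ k)` at level `k`. [folklore] -/
def Tmid (W₁ W₂ : (k : ℕ) → (idx L M k → ℂ)) (k : ℕ) : Matrix (idx L M k) (idx L M k) ℂ :=
  (Matrix.diagonal (W₁ k))ᴴ * calGlev L M a ha k * Matrix.diagonal (W₂ k)

/-- the same at level `k+1`, read at the syntactic successor level `L·n_k` (identity transport). [folklore] -/
def Tmidsucc (W₁ W₂ : (k : ℕ) → (idx L M k → ℂ)) (k : ℕ) :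
    Matrix (Tor (fine (L * lev L k) M) × Fin d) (Tor (fine (L * lev L k) M) × Fin d) ℂ :=
  (Matrix.diagonal (atSuccV L M k (W₁ (k + 1))))ᴴ * calG (L * lev L k) (one_le_lev' L (k + 1)) M a ha
    * Matrix.diagonal (atSuccV L M k (W₂ (k + 1)))

/-- **THE DRESSED ORDER-ZERO SLOT** `DRop W₁ W₂ k μ μ′ := ∇_{k,μ}ᴴ·T_k·∇_{k,μ′}` — between value legs `X, Y` its entries are
`⟨(W₁ k)·∇_μXe_p, 𝒢_k (W₂ k)·∇_{μ′}Ye_r⟩`, (P-R7a)'s V3 shape. [folklore] -/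
def DRop (W₁ W₂ : (k : ℕ) → (idx L M k → ℂ)) (k : ℕ) (μ μ' : Fin d) : Matrix (idx L M k) (idx L M k) ℂ :=
  (gradC (lev L k) M μ)ᴴ * Tmid L M a ha W₁ W₂ k * gradC (lev L k) M μ'

/-- the dressed slot of level `k+1` at the syntactic successor level. [folklore] -/
def DRopsucc (W₁ W₂ : (k : ℕ) → (idx L M k → ℂ)) (k : ℕ) (μ μ' : Fin d) :
    Matrix (Tor (fine (L * lev L k) M) × Fin d) (Tor (fine (L * lev L k) M) × Fin d) ℂ :=
  (gradF (lev L k) L M μ)ᴴ * Tmidsucc L M a ha W₁ W₂ k * gradF (lev L k) L M μ'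

/-- `DRop (k+1) = DRopsucc k` (definitional). [folklore] -/
theorem DRop_succ (W₁ W₂ : (k : ℕ) → (idx L M k → ℂ)) (k : ℕ) (μ μ' : Fin d) :
    DRop L M a ha W₁ W₂ (k + 1) μ μ' = DRopsucc L M a ha W₁ W₂ k μ μ' := rfl

/-- `‖DRopsucc k‖ ≤ (α+β)²·Cst` under the size and lattice-Lipschitz letters of the backgrounds at level `k+1`. [folklore] -/
theorem opNorm_DRopsucc_le (W₁ W₂ : (k : ℕ) → (idx L M k → ℂ)) {α β : ℝ} (hα : 0 ≤ α) (hβ : 0 ≤ β)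
    (hW₁ : ∀ k i, ‖W₁ k i‖ ≤ α) (hW₂ : ∀ k i, ‖W₂ k i‖ ≤ α)
    (hL₁ : ∀ k (μ : Fin d) i, ‖W₁ k i - shiftBack (lev L k) M μ (W₁ k) i‖ ≤ β / (lev L k : ℕ))
    (hL₂ : ∀ k (μ : Fin d) i, ‖W₂ k i - shiftBack (lev L k) M μ (W₂ k) i‖ ≤ β / (lev L k : ℕ)) (k : ℕ) (μ μ' : Fin d) :
    ‖DRopsucc L M a ha W₁ W₂ k μ μ'‖ ≤ (α + β) * ((α + β) * Cst d a) := by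
  have h := opNorm_dressedSlot_le (L * lev L k) (one_le_lev' L (k + 1)) M a ha μ μ' hα hβ (hW₁ (k + 1)) (hW₂ (k + 1))
    (hL₁ (k + 1) μ) (hL₂ (k + 1) μ')
  rw [DRopsucc, Tmidsucc]
  simpa only [Matrix.mul_assoc, atSuccV] using h

/-! ## §2 The dressed face-planted law along the tower; the sandwich -/

/-- **THE DRESSED FACE-PLANTED KING LAW ALONG THE TOWER** (`d ≥ 1`): `‖K_μᴴ·T_{k+1}·K_{μ′} − T_k‖ ≤ (α²·CK + 2α·L²·Cst·βc)·L^{−k}` under the size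
letter `α` and the consistency letter `‖W (k+1) x′ − W k (parT x′)‖ ≤ βc∕n_k`. [folklore] -/
theorem opNorm_faceK_dressed_sub_le_lev (hd : 1 ≤ d) (W₁ W₂ : (k : ℕ) → (idx L M k → ℂ)) {α βc : ℝ} (hα : 0 ≤ α) (hβc : 0 ≤ βc)
    (hW₁ : ∀ k i, ‖W₁ k i‖ ≤ α) (hW₂ : ∀ k i, ‖W₂ k i‖ ≤ α)
    (hc₁ : ∀ k (i : idx L M (k + 1)), ‖W₁ (k + 1) i - W₁ k (parT (lev L k) L M i)‖ ≤ βc / (lev L k : ℕ))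
    (hc₂ : ∀ k (i : idx L M (k + 1)), ‖W₂ (k + 1) i - W₂ k (parT (lev L k) L M i)‖ ≤ βc / (lev L k : ℕ)) (k : ℕ) (μ μ' : Fin d) :
    ‖(faceK (lev L k) L M μ)ᴴ * Tmidsucc L M a ha W₁ W₂ k * faceK (lev L k) L M μ' - Tmid L M a ha W₁ W₂ k‖
      ≤ (α * α * CK d L a + 2 * α * ((L : ℝ) * L) * Cst d a * βc) * ((L : ℝ)⁻¹) ^ k := by
  have hL1 : 1 ≤ L := Nat.pos_of_ne_zero (NeZero.ne L)
  have hlev : (0 : ℝ) < (lev L k : ℕ) := by exact_mod_cast one_le_lev' L k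
  have h := opNorm_faceK_dressed_sub_le' (lev L k) L M a ha hd (one_le_lev' L k) hL1 (one_le_lev' L (k + 1)) μ μ' hα
    (div_nonneg hβc hlev.le) (hW₁ k) (hW₂ k) (hW₂ (k + 1)) (hc₁ k) (hc₂ k)
  rw [Tmidsucc, Tmid, calGlev]
  refine h.trans (le_of_eq ?_)
  rw [cast_lev', div_eq_mul_inv, div_eq_mul_inv, ← inv_pow]
  ring

/-- the sandwich along the tower (exact): `J_kᴴ·DRopsucc_k·J_k − DRop_k = ∇_{k,μ}ᴴ·(K_μᴴ·T_{k+1}·K_{μ′} − T_k)·∇_{k,μ′}`. [folklore] -/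
theorem sandwich_dressed_sub_eq_lev (W₁ W₂ : (k : ℕ) → (idx L M k → ℂ)) (k : ℕ) (μ μ' : Fin d) :
    (Jpc L M k)ᴴ * DRopsucc L M a ha W₁ W₂ k μ μ' * Jpc L M k - DRop L M a ha W₁ W₂ k μ μ'
      = (gradC (lev L k) M μ)ᴴ * ((faceK (lev L k) L M μ)ᴴ * Tmidsucc L M a ha W₁ W₂ k * faceK (lev L k) L M μ' - Tmid L M a ha W₁ W₂ k)
        * gradC (lev L k) M μ' :=
  sandwich_general_sub_eq (lev L k) L M (one_le_lev' L k) μ μ' (Tmidsucc L M a ha W₁ W₂ k) (Tmid L M a ha W₁ W₂ k)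

/-! ## §3 Generic legs around the dressed slot -/

section Generic

variable {κ κ' : Type*} [Fintype κ] [DecidableEq κ] [Fintype κ'] [DecidableEq κ']

/-- **THE DRESSED-SLOT CHAIN BETWEEN GENERIC LEGS IS CAUCHY** (`d ≥ 1`): legs `‖X₁‖, ‖Y₀‖ ≤ αℓ`, one-step rates `‖X₁ − J_kX₀‖, ‖Y₁ − J_kY₀‖ ≤ ε`,
H¹ bounds `‖∇_{k,μ}X₀‖, ‖∇_{k,μ′}Y₀‖ ≤ βℓ`; backgrounds with size `α`, Lipschitz `β`, consistency `βc` ⟹ every entry of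
`X₁ᴴ·DRopsucc_k·Y₁ − X₀ᴴ·DRop_k·Y₀` is `≤ 2·αℓ·(α+β)²Cst·ε + βℓ·((α²CK + 2αL²Cst·βc)·L^{−k})·βℓ`.  R7 S4 for the word
«leg · ∇ᴴ · vertex · 𝒢 · vertex · ∇ · leg». [folklore] -/
theorem norm_dressedLegChain_sub_le (hd : 1 ≤ d) (W₁ W₂ : (k : ℕ) → (idx L M k → ℂ)) {α β βc : ℝ} (hα : 0 ≤ α) (hβ : 0 ≤ β) (hβc : 0 ≤ βc)
    (hW₁ : ∀ k i, ‖W₁ k i‖ ≤ α) (hW₂ : ∀ k i, ‖W₂ k i‖ ≤ α)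
    (hL₁ : ∀ k (μ : Fin d) i, ‖W₁ k i - shiftBack (lev L k) M μ (W₁ k) i‖ ≤ β / (lev L k : ℕ))
    (hL₂ : ∀ k (μ : Fin d) i, ‖W₂ k i - shiftBack (lev L k) M μ (W₂ k) i‖ ≤ β / (lev L k : ℕ))
    (hc₁ : ∀ k (i : idx L M (k + 1)), ‖W₁ (k + 1) i - W₁ k (parT (lev L k) L M i)‖ ≤ βc / (lev L k : ℕ))
    (hc₂ : ∀ k (i : idx L M (k + 1)), ‖W₂ (k + 1) i - W₂ k (parT (lev L k) L M i)‖ ≤ βc / (lev L k : ℕ))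
    (k : ℕ) (μ μ' : Fin d)
    (X₁ : Matrix (Tor (fine (L * lev L k) M) × Fin d) κ ℂ) (Y₁ : Matrix (Tor (fine (L * lev L k) M) × Fin d) κ' ℂ)
    (X₀ : Matrix (idx L M k) κ ℂ) (Y₀ : Matrix (idx L M k) κ' ℂ) {αℓ ε βℓ : ℝ} (hαℓ : 0 ≤ αℓ) (hε : 0 ≤ ε) (hβℓ : 0 ≤ βℓ)
    (hX₁ : ‖X₁‖ ≤ αℓ) (hY₀ : ‖Y₀‖ ≤ αℓ) (hXr : ‖X₁ - Jpc L M k * X₀‖ ≤ ε) (hYr : ‖Y₁ - Jpc L M k * Y₀‖ ≤ ε)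
    (hXg : ‖gradC (lev L k) M μ * X₀‖ ≤ βℓ) (hYg : ‖gradC (lev L k) M μ' * Y₀‖ ≤ βℓ) (p : κ) (r : κ') :
    ‖(X₁ᴴ * DRopsucc L M a ha W₁ W₂ k μ μ' * Y₁ - X₀ᴴ * DRop L M a ha W₁ W₂ k μ μ' * Y₀) p r‖
      ≤ 2 * (αℓ * ((α + β) * ((α + β) * Cst d a)) * ε)
        + βℓ * ((α * α * CK d L a + 2 * α * ((L : ℝ) * L) * Cst d a * βc) * ((L : ℝ)⁻¹) ^ k) * βℓ := by
  have hR' := opNorm_DRopsucc_le L M a ha W₁ W₂ hα hβ hW₁ hW₂ hL₁ hL₂ k μ μ'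
  have hS := opNorm_faceK_dressed_sub_le_lev L M a ha hd W₁ W₂ hα hβc hW₁ hW₂ hc₁ hc₂ k μ μ'
  have hCst := Cst_nonneg d a
  have hρ : 0 ≤ (α + β) * ((α + β) * Cst d a) := by positivity
  have hσ : 0 ≤ (α * α * CK d L a + 2 * α * ((L : ℝ) * L) * Cst d a * βc) * ((L : ℝ)⁻¹) ^ k := (norm_nonneg _).trans hS
  have hJY : ‖Jpc L M k * Y₀‖ ≤ αℓ :=
    (Matrix.l2_opNorm_mul _ _).trans ((mul_le_mul (opNorm_Jpc_le L M k) hY₀ (norm_nonneg _) zero_le_one).trans (le_of_eq (one_mul _)))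
  have h3 : X₀ᴴ * ((Jpc L M k)ᴴ * DRopsucc L M a ha W₁ W₂ k μ μ' * Jpc L M k - DRop L M a ha W₁ W₂ k μ μ') * Y₀
      = (gradC (lev L k) M μ * X₀)ᴴ
          * ((faceK (lev L k) L M μ)ᴴ * Tmidsucc L M a ha W₁ W₂ k * faceK (lev L k) L M μ' - Tmid L M a ha W₁ W₂ k)
          * (gradC (lev L k) M μ' * Y₀) := by
    rw [sandwich_dressed_sub_eq_lev, Matrix.conjTranspose_mul]
    simp only [Matrix.mul_assoc]
  rw [legChain_sub_eq X₁ Y₁ X₀ Y₀ (DRopsucc L M a ha W₁ W₂ k μ μ') (DRop L M a ha W₁ W₂ k μ μ') (Jpc L M k), Matrix.add_apply,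
    Matrix.add_apply, h3]
  have t1 : ‖(X₁ᴴ * DRopsucc L M a ha W₁ W₂ k μ μ' * (Y₁ - Jpc L M k * Y₀)) p r‖ ≤ αℓ * ((α + β) * ((α + β) * Cst d a)) * ε :=
    (norm_conjTranspose_mul_mul_apply_le _ _ _ p r).trans
      (mul_le_mul (mul_le_mul hX₁ hR' (norm_nonneg _) hαℓ) hYr (norm_nonneg _) (mul_nonneg hαℓ hρ))
  have t2 : ‖((X₁ - Jpc L M k * X₀)ᴴ * DRopsucc L M a ha W₁ W₂ k μ μ' * (Jpc L M k * Y₀)) p r‖ ≤ ε * ((α + β) * ((α + β) * Cst d a)) * αℓ :=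
    (norm_conjTranspose_mul_mul_apply_le _ _ _ p r).trans
      (mul_le_mul (mul_le_mul hXr hR' (norm_nonneg _) hε) hJY (norm_nonneg _) (mul_nonneg hε hρ))
  have t3 : ‖((gradC (lev L k) M μ * X₀)ᴴ
      * ((faceK (lev L k) L M μ)ᴴ * Tmidsucc L M a ha W₁ W₂ k * faceK (lev L k) L M μ' - Tmid L M a ha W₁ W₂ k)
      * (gradC (lev L k) M μ' * Y₀)) p r‖
        ≤ βℓ * ((α * α * CK d L a + 2 * α * ((L : ℝ) * L) * Cst d a * βc) * ((L : ℝ)⁻¹) ^ k) * βℓ :=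
    (norm_conjTranspose_mul_mul_apply_le _ _ _ p r).trans
      (mul_le_mul (mul_le_mul hXg hS (norm_nonneg _) hβℓ) hYg (norm_nonneg _) (mul_nonneg hβℓ hσ))
  calc _ ≤ ‖(X₁ᴴ * DRopsucc L M a ha W₁ W₂ k μ μ' * (Y₁ - Jpc L M k * Y₀)) p r
            + ((X₁ - Jpc L M k * X₀)ᴴ * DRopsucc L M a ha W₁ W₂ k μ μ' * (Jpc L M k * Y₀)) p r‖
          + ‖((gradC (lev L k) M μ * X₀)ᴴ
            * ((faceK (lev L k) L M μ)ᴴ * Tmidsucc L M a ha W₁ W₂ k * faceK (lev L k) L M μ' - Tmid L M a ha W₁ W₂ k)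
            * (gradC (lev L k) M μ' * Y₀)) p r‖ := norm_add_le _ _
    _ ≤ (αℓ * ((α + β) * ((α + β) * Cst d a)) * ε + ε * ((α + β) * ((α + β) * Cst d a)) * αℓ)
          + βℓ * ((α * α * CK d L a + 2 * α * ((L : ℝ) * L) * Cst d a * βc) * ((L : ℝ)⁻¹) ^ k) * βℓ :=
        add_le_add ((norm_add_le _ _).trans (add_le_add t1 t2)) t3
    _ = _ := by ring

end Generic

/-! ## §4 The instances: soft and hard legs -/

/-- **THE SOFT-LEG V3-TYPE CHAIN** `M̃_kᴴ·DRop_k·M̃_k` (entries `⟨(W₁ k)∇_μM̃_ke_p, 𝒢_k(W₂ k)∇_{μ′}M̃_ke_r⟩` = the physical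
`⟨h₁∇_μu_p, 𝒢_kh₂∇_{μ′}u_r⟩_{L²(T_η)}`) **IS ENTRYWISE CAUCHY AT RATE `L^{−k}` MODULO THE BACKGROUND's THREE LETTERS** (`d ≥ 1`):
`≤ (2·(aCst)·(α+β)²Cst·(aCQH) + (aCst)²·(α²CK + 2αL²Cst·βc))·L^{−k}`. [folklore] -/
theorem norm_softDressedChain_succ_sub_le (hd : 1 ≤ d) (W₁ W₂ : (k : ℕ) → (idx L M k → ℂ)) {α β βc : ℝ} (hα : 0 ≤ α) (hβ : 0 ≤ β)
    (hβc : 0 ≤ βc) (hW₁ : ∀ k i, ‖W₁ k i‖ ≤ α) (hW₂ : ∀ k i, ‖W₂ k i‖ ≤ α)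
    (hL₁ : ∀ k (μ : Fin d) i, ‖W₁ k i - shiftBack (lev L k) M μ (W₁ k) i‖ ≤ β / (lev L k : ℕ))
    (hL₂ : ∀ k (μ : Fin d) i, ‖W₂ k i - shiftBack (lev L k) M μ (W₂ k) i‖ ≤ β / (lev L k : ℕ))
    (hc₁ : ∀ k (i : idx L M (k + 1)), ‖W₁ (k + 1) i - W₁ k (parT (lev L k) L M i)‖ ≤ βc / (lev L k : ℕ))
    (hc₂ : ∀ k (i : idx L M (k + 1)), ‖W₂ (k + 1) i - W₂ k (parT (lev L k) L M i)‖ ≤ βc / (lev L k : ℕ))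
    (k : ℕ) (μ μ' : Fin d) (p r : idx L M 0) :
    ‖((atSucc' L M k (Mtil L M a ha (k + 1)))ᴴ * DRopsucc L M a ha W₁ W₂ k μ μ' * atSucc' L M k (Mtil L M a ha (k + 1))
        - (Mtil L M a ha k)ᴴ * DRop L M a ha W₁ W₂ k μ μ' * Mtil L M a ha k) p r‖
      ≤ (2 * ((a * Cst d a) * ((α + β) * ((α + β) * Cst d a)) * (a * CQH d a))
          + (a * Cst d a) * (α * α * CK d L a + 2 * α * ((L : ℝ) * L) * Cst d a * βc) * (a * Cst d a)) * ((L : ℝ)⁻¹) ^ k := by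
  have hA : ‖Mtil L M a ha k‖ ≤ a * Cst d a := opNorm_Mtil_le L M a ha k
  have hD : ‖atSucc' L M k (Mtil L M a ha (k + 1)) - Jpc L M k * Mtil L M a ha k‖ ≤ a * CQH d a * ((L : ℝ)⁻¹) ^ k :=
    opNorm_Mtil_succ_sub_le L M a ha k
  have h := norm_dressedLegChain_sub_le L M a ha hd W₁ W₂ hα hβ hβc hW₁ hW₂ hL₁ hL₂ hc₁ hc₂ k μ μ'
    (atSucc' L M k (Mtil L M a ha (k + 1))) (atSucc' L M k (Mtil L M a ha (k + 1))) (Mtil L M a ha k) (Mtil L M a ha k)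
    (mul_nonneg ha.le (Cst_nonneg d a)) ((norm_nonneg _).trans hD) (mul_nonneg ha.le (Cst_nonneg d a))
    (opNorm_Mtil_le L M a ha (k + 1)) hA hD hD (opNorm_grad_Mtil_le L M a ha k μ) (opNorm_grad_Mtil_le L M a ha k μ') p r
  refine h.trans (le_of_eq ?_)
  ring

/-- **THE HARD-LEG V3-TYPE CHAIN** `M̂_kᴴ·DRop_k·M̂_k` (`M̂ = n^{−d∕2}·H_k`, `HardColumnChains.Mhat_mulVec`) **IS ENTRYWISE CAUCHY AT RATE `L^{−k}`
MODULO THE BACKGROUND's THREE LETTERS** (`d ≥ 1`): `≤ (2·(Cst∕γ)·(α+β)²Cst·CHH + (Cst∕γ)²·(α²CK + 2αL²Cst·βc))·L^{−k}`. [folklore] -/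
theorem norm_hardDressedChain_succ_sub_le (hd : 1 ≤ d) (W₁ W₂ : (k : ℕ) → (idx L M k → ℂ)) {α β βc : ℝ} (hα : 0 ≤ α) (hβ : 0 ≤ β)
    (hβc : 0 ≤ βc) (hW₁ : ∀ k i, ‖W₁ k i‖ ≤ α) (hW₂ : ∀ k i, ‖W₂ k i‖ ≤ α)
    (hL₁ : ∀ k (μ : Fin d) i, ‖W₁ k i - shiftBack (lev L k) M μ (W₁ k) i‖ ≤ β / (lev L k : ℕ))
    (hL₂ : ∀ k (μ : Fin d) i, ‖W₂ k i - shiftBack (lev L k) M μ (W₂ k) i‖ ≤ β / (lev L k : ℕ))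
    (hc₁ : ∀ k (i : idx L M (k + 1)), ‖W₁ (k + 1) i - W₁ k (parT (lev L k) L M i)‖ ≤ βc / (lev L k : ℕ))
    (hc₂ : ∀ k (i : idx L M (k + 1)), ‖W₂ (k + 1) i - W₂ k (parT (lev L k) L M i)‖ ≤ βc / (lev L k : ℕ))
    (k : ℕ) (μ μ' : Fin d) (p r : idx L M 0) :
    ‖((atSucc' L M k (Mhat L M a ha (k + 1)))ᴴ * DRopsucc L M a ha W₁ W₂ k μ μ' * atSucc' L M k (Mhat L M a ha (k + 1))
        - (Mhat L M a ha k)ᴴ * DRop L M a ha W₁ W₂ k μ μ' * Mhat L M a ha k) p r‖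
      ≤ (2 * ((Cst d a * (gammaB d a)⁻¹) * ((α + β) * ((α + β) * Cst d a)) * CHH d a)
          + (Cst d a * (gammaB d a)⁻¹) * (α * α * CK d L a + 2 * α * ((L : ℝ) * L) * Cst d a * βc) * (Cst d a * (gammaB d a)⁻¹))
        * ((L : ℝ)⁻¹) ^ k := by
  have hαℓ : 0 ≤ Cst d a * (gammaB d a)⁻¹ := mul_nonneg (Cst_nonneg d a) (inv_nonneg.mpr (gammaB_pos (d := d) a ha).le)
  have hD := opNorm_Mhat_succ_sub_le L M a ha k
  have h := norm_dressedLegChain_sub_le L M a ha hd W₁ W₂ hα hβ hβc hW₁ hW₂ hL₁ hL₂ hc₁ hc₂ k μ μ'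
    (atSucc' L M k (Mhat L M a ha (k + 1))) (atSucc' L M k (Mhat L M a ha (k + 1))) (Mhat L M a ha k) (Mhat L M a ha k)
    hαℓ ((norm_nonneg _).trans hD) hαℓ (opNorm_Mhat_le L M a ha (k + 1)) (opNorm_Mhat_le L M a ha k) hD hD
    (opNorm_grad_Mhat_le L M a ha k μ) (opNorm_grad_Mhat_le L M a ha k μ') p r
  refine h.trans (le_of_eq ?_)
  ring

end Summit.QuantumFields.BalabanUV.Beta.GAN24.DressedOrderZeroChain

end
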